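import Literature.MathematicalPhysics.QuantumLattice.FreeFermiGasPairingCostOptimal
import Literature.MathematicalPhysics.QuantumLattice.TorusInverseGapSumOffVanHove
import Literature.MathematicalPhysics.QuantumLattice.TorusBandParticleHole
import HarnessLib

/-!
# `d`-wave pair LRO costs kinetic energy at the Bardeen–Cooper–Schrieffer rate `a / log(1/a)`

Family `hubbard` / topic `MathematicalPhysics/QuantumLattice`; fourth stage of the pairing-cost
files (`a⁶`, `a²`, `a^{3/2}`). With the SAME operator input as the `a^{3/2}` rate (triangle bounds
`√(a/8)L² ≤ 2Σ√dev + 2L`, exact bathtub identity `Σ|ξ|dev ≤ K`, one Cauchy–Schwarz against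
`Σ 1/|ξ|`), but the LOGARITHMIC inverse-gap sum `Σ_{|ξ|≥e₀} 1/|ξ| = O(L² log(1/e₀)/√d₀)`
(`TorusInverseGapSumOffVanHove.lean`) and the linear window count (`card_torusShell_le`), valid when
the Fermi level sits in `[-4 + d₀, -d₀]` — away from the van Hove level and the band bottom:

* `freeDWavePairing_costs_energy_log_explicit`: for `a > 0`, `d₀ > 0`, `L ≥ 3` with
  `a·L² ≥ 12800`, `√d₀·L ≥ 40`, a unit `ψ ∈ szSector (2n) 0` whose level counting function places
  `n` levels per spin in `[-4 + d₀, -d₀]` (`n ≤ #{ε ≤ -d₀}`, `#{ε < -4 + d₀} < n`), and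
  `Re ⟨ψ, Δ_d†Δ_d ψ⟩ ≥ a·L⁴`:
  `minEnergyOn H₀ (szSector (2n) 0) + √d₀ · a / (4096 · log(4 + 32/√a)) · L² ≤ Re ⟨ψ, H₀ ψ⟩`.

This is the BCS rate: a trial BCS state with gap `Δ` has `d`-wave pair density `a ≍ Δ² log²(1/Δ)`
at kinetic cost `≍ Δ² log(1/Δ) · L² ≍ a L²/log(1/a)`, so no energy-balance argument can do better
than `η(a) ≍ a/log(1/a)`; the only remaining slack towards the expected `e^{-O(1/U)}` law of the
Hubbard ground state is the first-order kinetic budget `U·L²`, not the pairing cost. The Fermi-level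
hypotheses hold at filling `1 - δ`, `δ ∈ (0,1/2)`, for even `L` (`TorusBandParticleHole.lean`);
consumers: `HubbardPairDensityCouplingFloorLog.lean` and the Summits-side window floor.

Sources: J. Bardeen, L. N. Cooper, J. R. Schrieffer, Phys. Rev. 108 (1957) 1175, §II–III (gap
equation, condensation energy `½N(0)Δ²`, pair amplitude `N(0)Δ log(2ω/Δ)`); E. H. Lieb, M. Loss,
Analysis (2001), Thm 1.14; C. N. Yang, Rev. Mod. Phys. 34 (1962) 694, §3. Folklore
finite-dimensional statements; no named facts, no definitions.

## Mathlib / tree search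

Tree: `sqrt_le_deviation_of_le_re_expect_pairField_dWave`, `exists_fermiSet_deviation_le_energy_excess`,
`sum_abs_sub_mul_deviation_le_energy_excess` (any separating level), `exists_level_mem_Icc_of_card`,
`card_torusShell_le`, `sum_inv_abs_sub_le_log`, `freeDWavePairing_costs_energy_opt_explicit`.
Mathlib: `Real.sum_sqrt_mul_sqrt_le`, `min_cases`, `Real.log_le_log`, `Real.sqrt_div'`,
`Real.le_log_iff_exp_le`, `Real.pi_gt_three`.
-/

noncomputable section

namespace Literature.MathematicalPhysics.QuantumLattice

open Matrix Finset Literature.Probability.LatticeModels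
open scoped ComplexOrder ComplexConjugate

variable {L : ℕ} [NeZero L]

/-- `√d₀ ≤ π √(d₀/8)` (`π² ≥ 8`; local copy). [folklore] -/
private theorem sqrt_le_pi_mul_sqrt_div_eight' {d₀ : ℝ} (hd : 0 ≤ d₀) :
    Real.sqrt d₀ ≤ Real.pi * Real.sqrt (d₀ / 8) := by
  have hπ := Real.pi_gt_three
  have h0 : 0 ≤ Real.pi * Real.sqrt (d₀ / 8) := by positivity
  have hsq : d₀ ≤ (Real.pi * Real.sqrt (d₀ / 8)) ^ 2 := by
    rw [mul_pow, Real.sq_sqrt (by positivity)]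
    have hπ2 : 9 ≤ Real.pi ^ 2 := by nlinarith
    nlinarith [mul_le_mul_of_nonneg_right hπ2 hd]
  calc Real.sqrt d₀ ≤ Real.sqrt ((Real.pi * Real.sqrt (d₀ / 8)) ^ 2) := Real.sqrt_le_sqrt hsq
    _ = Real.pi * Real.sqrt (d₀ / 8) := Real.sqrt_sq h0

/-- `1 ≤ log 4` (`e < 4`; local copy). [folklore] -/
private theorem one_le_log_four' : (1 : ℝ) ≤ Real.log 4 := by
  rw [Real.le_log_iff_exp_le (by norm_num)]
  exact Real.exp_one_lt_d9.le.trans (by norm_num)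

/-- **`d`-wave pair LRO costs kinetic energy — the logarithmic (BCS) rate, explicit constants.**
For `a > 0`, `d₀ > 0`, `L ≥ 3` with `a·L² ≥ 12800` and `√d₀·L ≥ 40`, a unit vector
`ψ ∈ szSector (2n) 0` with `n ≤ #{k : ε_L(k) ≤ -d₀}` and `#{k : ε_L(k) < -4 + d₀} < n` (the Fermi
level of `n` levels per spin lies in `[-4 + d₀, -d₀]`), and `Re ⟨ψ, Δ_d†Δ_d ψ⟩ ≥ a·L⁴`:
`minEnergyOn H₀ (szSector (2n) 0) + √d₀·a/(4096·log(4 + 32/√a))·L² ≤ Re ⟨ψ, H₀ ψ⟩`,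
`H₀ = hubbardTorus 2 L 1 0`. Proof: as the `a^{3/2}` rate with the window
`e₀ = min(α√d₀/16, d₀/8)`, `α = √(a/8)`: the window holds at most `αL²/8 + 4L` momenta (linear
count), outside `Σ√dev ≤ √K·√W` with `W ≤ 25 log(d₀/(2e₀)) L²/√d₀`, whence
`a√d₀ L² ≤ 3200 K log(d₀/(2e₀))` and `d₀/(2e₀) ≤ 4 + 32/√a`. Bardeen–Cooper–Schrieffer (1957) §II.
[folklore] -/
theorem freeDWavePairing_costs_energy_log_explicit {a d₀ : ℝ} (ha : 0 < a) (hd : 0 < d₀)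
    (hL : 3 ≤ L) (hLa : 12800 ≤ a * (L : ℝ) ^ 2) (hLd : 40 ≤ Real.sqrt d₀ * L) {n : ℕ}
    {ψ : Fock (Orb (FermionTorus 2 L))}
    (hψ : ψ ∈ szSector (Λ := FermionTorus 2 L) (2 * n) 0) (h1 : star ψ ⬝ᵥ ψ = 1)
    (hC1 : n ≤ (Finset.univ.filter fun k : TorusSite 2 L => torusBand L k ≤ -d₀).card)
    (hC2 : (Finset.univ.filter fun k : TorusSite 2 L => torusBand L k < (-4 : ℝ) + d₀).card < n)
    (hY : a * (L : ℝ) ^ 4 ≤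
      (star ψ ⬝ᵥ (((pairField dWaveFormFactor L)ᴴ * pairField dWaveFormFactor L) *ᵥ ψ)).re) :
    (hubbardTorus 2 L 1 0).minEnergyOn (szSector (Λ := FermionTorus 2 L) (2 * n) 0) +
        Real.sqrt d₀ * a / (4096 * Real.log (4 + 32 / Real.sqrt a)) * (L : ℝ) ^ 2 ≤
      (star ψ ⬝ᵥ (hubbardTorus 2 L 1 0 *ᵥ ψ)).re := by
  classical
  -- a Fermi set and a level in `[-4 + d₀, -d₀]`
  obtain ⟨F, eF₁, hFc, hF₁, hF₁', -⟩ := exists_fermiSet_deviation_le_energy_excess hL hψ h1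
  have hexch : ∀ k ∈ F, ∀ k' ∉ F, torusBand L k ≤ torusBand L k' := fun k hk k' hk' =>
    (hF₁ k hk).trans (hF₁' k' hk')
  obtain ⟨eF, heF4, heF0, hF, hF'⟩ := exists_level_mem_Icc_of_card (torusBand L) F
    (a := (-4 : ℝ) + d₀) (b := -d₀) hexch (by rw [hFc]; exact hC1) (by rw [hFc]; exact hC2)
  have hμ4 : d₀ ≤ eF + 4 := by linarith
  have hμ0 : d₀ ≤ -eF := by linarith
  have hd2 : d₀ ≤ 2 := by linarith
  have hdev := sum_abs_sub_mul_deviation_le_energy_excess hL hψ h1 F eF hFc hF hF'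
  -- occupations and deviations
  obtain ⟨x, hx⟩ : ∃ x : TorusSite 2 L → ℝ, ∀ k, (star ψ ⬝ᵥ (momentumNumber k 0 *ᵥ ψ)).re = x k :=
    ⟨_, fun _ => rfl⟩
  simp only [hx] at hdev
  have hx0 : ∀ k, 0 ≤ x k := fun k => by rw [← hx]; exact (re_expect_momentumNumber_mem_Icc k 0 ψ).1
  have hx1 : ∀ k, x k ≤ 1 := fun k => by
    have := (re_expect_momentumNumber_mem_Icc k 0 ψ).2
    rwa [h1, Complex.one_re, hx] at this
  set dev : TorusSite 2 L → ℝ := fun k => if k ∈ F then 1 - x k else x k with hdev_def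
  have hd0 : ∀ k, 0 ≤ dev k := fun k => by
    simp only [hdev_def]; split_ifs <;> linarith [hx0 k, hx1 k]
  have hd1 : ∀ k, dev k ≤ 1 := fun k => by
    simp only [hdev_def]; split_ifs <;> linarith [hx0 k, hx1 k]
  set K : ℝ := (star ψ ⬝ᵥ (hubbardTorus 2 L 1 0 *ᵥ ψ)).re -
    (hubbardTorus 2 L 1 0).minEnergyOn (szSector (Λ := FermionTorus 2 L) (2 * n) 0) with hK
  set ξ : TorusSite 2 L → ℝ := fun k => |torusBand L k - eF| with hξ
  have hξ0 : ∀ k, 0 ≤ ξ k := fun k => abs_nonneg _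
  have hdevK : ∑ k, ξ k * dev k ≤ K := hdev
  have hK0 : 0 ≤ K := le_trans (Finset.sum_nonneg fun k _ => mul_nonneg (hξ0 k) (hd0 k)) hdevK
  -- scales
  set α : ℝ := Real.sqrt (a / 8) with hα
  have hα0 : 0 < α := Real.sqrt_pos.2 (by positivity)
  have hα2 : α ^ 2 = a / 8 := Real.sq_sqrt (by positivity)
  set sd : ℝ := Real.sqrt d₀ with hsd
  have hsd0 : 0 < sd := Real.sqrt_pos.2 hd
  have hsd2 : sd ^ 2 = d₀ := Real.sq_sqrt hd.le
  have hsd1 : sd ≤ Real.sqrt 2 := Real.sqrt_le_sqrt hd2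
  have hL0' : (0 : ℝ) < L := by exact_mod_cast (show 0 < L by omega)
  set s₀ : ℝ := Real.sqrt (d₀ / 8) with hs₀
  have hs₀0 : 0 < s₀ := Real.sqrt_pos.2 (by positivity)
  have hsds : sd ≤ Real.pi * s₀ := sqrt_le_pi_mul_sqrt_div_eight' hd.le
  -- Step 1: triangle bounds `α L² ≤ 2 Σ √dev + 2L`
  have hstep1 : α * (L : ℝ) ^ 2 ≤ 2 * ∑ k, Real.sqrt (dev k) + 2 * L := by
    have h := sqrt_le_deviation_of_le_re_expect_pairField_dWave F h1 hY
    simp only [hx] at h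
    have hS : ∑ k ∈ Fᶜ, Real.sqrt (x k) + ∑ k ∈ F, Real.sqrt (1 - x k) = ∑ k, Real.sqrt (dev k) := by
      rw [← Finset.sum_add_sum_compl F fun k => Real.sqrt (dev k), add_comm]
      congr 1
      · exact Finset.sum_congr rfl fun k hk => by
          rw [hdev_def]; dsimp only; rw [if_pos hk]
      · exact Finset.sum_congr rfl fun k hk => by
          rw [hdev_def]; dsimp only; rw [if_neg (Finset.mem_compl.1 hk)]
    have hFx : Real.sqrt (∑ k ∈ F, x k) ≤ L := by
      have hle : ∑ k ∈ F, x k ≤ (L : ℝ) ^ 2 := by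
        calc ∑ k ∈ F, x k ≤ ∑ k ∈ F, (1 : ℝ) := Finset.sum_le_sum fun k _ => hx1 k
          _ = F.card := by rw [Finset.sum_const, nsmul_eq_mul, mul_one]
          _ ≤ (L : ℝ) ^ 2 := by
              have := Finset.card_le_univ F
              rw [card_torusSite] at this
              exact_mod_cast this
      calc Real.sqrt (∑ k ∈ F, x k) ≤ Real.sqrt ((L : ℝ) ^ 2) := Real.sqrt_le_sqrt hle
        _ = L := Real.sqrt_sq hL0'.le
    rw [← hα] at h
    linarith
  -- Step 2: the window `e₀ = min (α √d₀ / 16) (d₀ / 8)`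
  set e₀ : ℝ := min (α * sd / 16) (d₀ / 8) with he₀
  have he0 : 0 < e₀ := lt_min (by positivity) (by positivity)
  have heα : e₀ ≤ α * sd / 16 := min_le_left _ _
  have hed : e₀ ≤ d₀ / 8 := min_le_right _ _
  have he8 : 8 * e₀ ≤ d₀ := by linarith
  have he2 : e₀ ≤ d₀ / 2 := by linarith
  have hinv : 1 / e₀ ≤ 16 / (α * sd) + 8 / d₀ := by
    have hp : 0 < 16 / (α * sd) := by positivity
    have hq : 0 < 8 / d₀ := by positivity
    rcases min_cases (α * sd / 16) (d₀ / 8) with ⟨h, _⟩ | ⟨h, _⟩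
    · rw [he₀, h, one_div_div]; linarith
    · rw [he₀, h, one_div_div]; linarith
  -- the window holds few momenta (linear count off van Hove)
  have hwindow : ∑ k ∈ Finset.univ.filter (fun k => ¬ e₀ ≤ ξ k), Real.sqrt (dev k) ≤
      α / 8 * (L : ℝ) ^ 2 + 4 * L := by
    calc ∑ k ∈ Finset.univ.filter (fun k => ¬ e₀ ≤ ξ k), Real.sqrt (dev k)
        ≤ ∑ k ∈ Finset.univ.filter (fun k => ¬ e₀ ≤ ξ k), (1 : ℝ) :=
          Finset.sum_le_sum fun k _ => by
            rw [show (1 : ℝ) = Real.sqrt 1 from Real.sqrt_one.symm]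
            exact Real.sqrt_le_sqrt (hd1 k)
      _ = ((Finset.univ.filter (fun k => ¬ e₀ ≤ ξ k)).card : ℝ) := by
          rw [Finset.sum_const, nsmul_eq_mul, mul_one]
      _ = ((Finset.univ.filter (fun k : TorusSite 2 L => |torusBand L k - eF| < e₀)).card : ℝ) := by
          congr 2
          refine Finset.filter_congr fun k _ => ?_
          rw [hξ, not_le]
      _ ≤ 4 * (L * (e₀ * L / (2 * Real.pi * s₀) + 1)) := card_torusShell_le hμ4 hμ0 he0 he2
      _ = 2 / (Real.pi * s₀) * e₀ * (L : ℝ) ^ 2 + 4 * L := by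
          field_simp
          ring
      _ ≤ 2 / sd * e₀ * (L : ℝ) ^ 2 + 4 * L := by
          have hD : 2 / (Real.pi * s₀) ≤ 2 / sd := div_le_div_of_nonneg_left (by norm_num) hsd0 hsds
          have := mul_le_mul_of_nonneg_right hD (mul_nonneg he0.le (sq_nonneg (L : ℝ)))
          have e1 : 2 / (Real.pi * s₀) * (e₀ * (L : ℝ) ^ 2) = 2 / (Real.pi * s₀) * e₀ * (L : ℝ) ^ 2 := by ring
          have e2 : 2 / sd * (e₀ * (L : ℝ) ^ 2) = 2 / sd * e₀ * (L : ℝ) ^ 2 := by ring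
          linarith
      _ ≤ α / 8 * (L : ℝ) ^ 2 + 4 * L := by
          have h2 : 2 / sd * e₀ ≤ α / 8 := by
            rw [div_mul_eq_mul_div, div_le_iff₀ hsd0]
            linarith
          have := mul_le_mul_of_nonneg_right h2 (sq_nonneg (L : ℝ))
          linarith
  -- outside the window: Cauchy–Schwarz against the logarithmic inverse-gap sum
  set ℓ : ℝ := Real.log (d₀ / (2 * e₀)) with hℓ
  set W : ℝ := 8 / sd * (L : ℝ) ^ 2 * ℓ + 12 * (L : ℝ) ^ 2 / sd + 6 * L / e₀ + 32 * L / d₀ with hW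
  have hℓ1 : 1 ≤ ℓ := by
    have h4 : (4 : ℝ) ≤ d₀ / (2 * e₀) := by
      rw [le_div_iff₀ (by positivity)]
      linarith
    exact one_le_log_four'.trans (Real.log_le_log (by norm_num) h4)
  have hW0 : 0 ≤ W := by
    have : 0 ≤ ℓ := by linarith
    positivity
  have houtside : ∑ k ∈ Finset.univ.filter (fun k => e₀ ≤ ξ k), Real.sqrt (dev k) ≤
      Real.sqrt K * Real.sqrt W := by
    have hcs := Real.sum_sqrt_mul_sqrt_le (Finset.univ.filter (fun k => e₀ ≤ ξ k))
      (f := fun k => ξ k * dev k) (g := fun k => 1 / ξ k)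
      (fun k => mul_nonneg (hξ0 k) (hd0 k)) (fun k => by positivity)
    have heq : ∀ k ∈ Finset.univ.filter (fun k => e₀ ≤ ξ k),
        Real.sqrt (dev k) = Real.sqrt (ξ k * dev k) * Real.sqrt (1 / ξ k) := by
      intro k hk
      have hk' : 0 < ξ k := lt_of_lt_of_le he0 (Finset.mem_filter.1 hk).2
      rw [← Real.sqrt_mul (mul_nonneg (hξ0 k) (hd0 k)), mul_comm (ξ k), mul_assoc,
        mul_one_div_cancel hk'.ne', mul_one]
    rw [Finset.sum_congr rfl heq]
    refine hcs.trans (mul_le_mul ?_ ?_ (Real.sqrt_nonneg _) (Real.sqrt_nonneg _))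
    · refine Real.sqrt_le_sqrt (le_trans ?_ hdevK)
      exact Finset.sum_le_sum_of_subset_of_nonneg (Finset.filter_subset _ _)
        fun k _ _ => mul_nonneg (hξ0 k) (hd0 k)
    · refine Real.sqrt_le_sqrt ((sum_inv_abs_sub_le_log (L := L) hμ4 hμ0 he0 he8).trans (le_of_eq ?_))
      rw [hW, hℓ, hsd]
  have hsplit : ∑ k, Real.sqrt (dev k) =
      ∑ k ∈ Finset.univ.filter (fun k => e₀ ≤ ξ k), Real.sqrt (dev k) +
        ∑ k ∈ Finset.univ.filter (fun k => ¬ e₀ ≤ ξ k), Real.sqrt (dev k) :=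
    (Finset.sum_filter_add_sum_filter_not _ _ _).symm
  -- Step 3: the threshold `α L ≥ 40`, combine and square
  have hαL : 40 ≤ α * L := by
    have h2 : (40 : ℝ) ^ 2 ≤ (α * L) ^ 2 := by
      rw [mul_pow, hα2]
      norm_num
      linarith
    exact le_of_pow_le_pow_left₀ two_ne_zero (by positivity) h2
  have hmain : α / 2 * (L : ℝ) ^ 2 ≤ 2 * (Real.sqrt K * Real.sqrt W) := by
    have h10 : 10 * (L : ℝ) ≤ α / 4 * (L : ℝ) ^ 2 := by
      have := mul_nonneg (sub_nonneg.2 hαL) hL0'.le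
      have e : (α * L - 40) * (L : ℝ) = α * (L : ℝ) ^ 2 - 40 * L := by ring
      linarith
    rw [hsplit] at hstep1
    linarith
  have hsq : (α / 2 * (L : ℝ) ^ 2) ^ 2 ≤ 4 * (K * W) := by
    have h := pow_le_pow_left₀ (by positivity) hmain 2
    have e : (2 * (Real.sqrt K * Real.sqrt W)) ^ 2 = 4 * (K * W) := by
      rw [mul_pow, mul_pow, Real.sq_sqrt hK0, Real.sq_sqrt hW0]
      norm_num
    rwa [e] at h
  -- Step 4: `W ≤ 25 ℓ L²/√d₀`
  have hWle : W ≤ 25 * ℓ * (L : ℝ) ^ 2 / sd := by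
    have hsdL : 40 ≤ sd * L := hLd
    -- `6L/e₀ ≤ 96 L/(α sd) + 48 L/d₀`
    have h6 : 6 * (L : ℝ) / e₀ ≤ 96 * L / (α * sd) + 48 * L / d₀ := by
      have := mul_le_mul_of_nonneg_left hinv (show 0 ≤ 6 * (L : ℝ) by positivity)
      have e1 : 6 * (L : ℝ) * (1 / e₀) = 6 * L / e₀ := by ring
      have e2 : 6 * (L : ℝ) * (16 / (α * sd) + 8 / d₀) = 96 * L / (α * sd) + 48 * L / d₀ := by ring
      linarith
    -- `96 L/(α sd) ≤ (12/5) L²/sd` from `α L ≥ 40`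
    have h96 : 96 * (L : ℝ) / (α * sd) ≤ 12 / 5 * (L : ℝ) ^ 2 / sd := by
      rw [div_le_div_iff₀ (by positivity) hsd0]
      have : 0 ≤ (L : ℝ) * sd := by positivity
      have h := mul_le_mul_of_nonneg_left hαL this
      have e1 : (L : ℝ) * sd * 40 = 40 * (L * sd) := by ring
      have e2 : (L : ℝ) * sd * (α * L) = α * (L * sd) * L := by ring
      have e3 : 96 * (L : ℝ) * sd = 96 * (L * sd) := by ring
      have e4 : 12 / 5 * (L : ℝ) ^ 2 * (α * sd) = 12 / 5 * (α * (L * sd) * L) := by ring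
      rw [e3, e4]
      rw [e1, e2] at h
      linarith
    -- `80 L/d₀ ≤ 2 L²/sd` from `sd L ≥ 40`
    have h80 : 80 * (L : ℝ) / d₀ ≤ 2 * (L : ℝ) ^ 2 / sd := by
      rw [← hsd2, div_le_div_iff₀ (by positivity) hsd0]
      have : 0 ≤ (L : ℝ) * sd := by positivity
      have h := mul_le_mul_of_nonneg_left hsdL this
      have e1 : (L : ℝ) * sd * 40 = 40 * (L * sd) := by ring
      have e2 : (L : ℝ) * sd * (sd * L) = (L * sd) * (L * sd) := by ring
      have e3 : 80 * (L : ℝ) * sd = 80 * (L * sd) := by ring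
      have e4 : 2 * (L : ℝ) ^ 2 * sd ^ 2 = 2 * ((L * sd) * (L * sd)) := by ring
      rw [e3, e4]
      rw [e1, e2] at h
      linarith
    have hL2sd : 0 ≤ (L : ℝ) ^ 2 / sd := by positivity
    have e48 : 48 * (L : ℝ) / d₀ + 32 * L / d₀ = 80 * L / d₀ := by ring
    have esum : 8 / sd * (L : ℝ) ^ 2 * ℓ + 12 * (L : ℝ) ^ 2 / sd + 12 / 5 * (L : ℝ) ^ 2 / sd +
        2 * (L : ℝ) ^ 2 / sd = (8 * ℓ + 82 / 5) * ((L : ℝ) ^ 2 / sd) := by ring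
    have efin : 25 * ℓ * (L : ℝ) ^ 2 / sd = (25 * ℓ) * ((L : ℝ) ^ 2 / sd) := by ring
    have hcoef : (8 * ℓ + 82 / 5) * ((L : ℝ) ^ 2 / sd) ≤ (25 * ℓ) * ((L : ℝ) ^ 2 / sd) :=
      mul_le_mul_of_nonneg_right (by linarith) hL2sd
    rw [hW]
    linarith
  -- Step 5: `a √d₀ L² ≤ 3200 K ℓ`
  have hcore : a * sd * (L : ℝ) ^ 2 ≤ 3200 * K * ℓ := by
    have h1' : (α / 2 * (L : ℝ) ^ 2) ^ 2 ≤ 4 * (K * (25 * ℓ * (L : ℝ) ^ 2 / sd)) :=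
      hsq.trans (mul_le_mul_of_nonneg_left (mul_le_mul_of_nonneg_left hWle hK0) (by norm_num))
    have h2' : 4 * (K * (25 * ℓ * (L : ℝ) ^ 2 / sd)) = (100 * K * ℓ * (L : ℝ) ^ 2) / sd := by ring
    rw [h2', le_div_iff₀ hsd0] at h1'
    have hL2 : (0 : ℝ) < (L : ℝ) ^ 2 := by positivity
    have h3 : a * sd * (L : ℝ) ^ 2 * (L : ℝ) ^ 2 ≤ 3200 * K * ℓ * (L : ℝ) ^ 2 := by
      have : (α / 2 * (L : ℝ) ^ 2) ^ 2 * sd = a / 32 * sd * (L : ℝ) ^ 2 * (L : ℝ) ^ 2 := by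
        rw [mul_pow, div_pow, hα2]; ring
      rw [this] at h1'
      linarith [h1']
    exact le_of_mul_le_mul_right h3 hL2
  -- Step 6: `ℓ ≤ log (4 + 32/√a)`
  have hℓle : ℓ ≤ Real.log (4 + 32 / Real.sqrt a) := by
    have hsa : Real.sqrt a = Real.sqrt 8 * α := by
      rw [hα, ← Real.sqrt_mul (by norm_num : (0 : ℝ) ≤ 8)]
      congr 1
      ring
    have hsa0 : 0 < Real.sqrt a := Real.sqrt_pos.2 ha
    -- `d₀/(2e₀) ≤ 4 + 8 sd/α ≤ 4 + 32/√a`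
    have hq : d₀ / (2 * e₀) ≤ 4 + 8 * sd / α := by
      have := mul_le_mul_of_nonneg_left hinv (show 0 ≤ d₀ / 2 by positivity)
      have e1 : d₀ / 2 * (1 / e₀) = d₀ / (2 * e₀) := by
        field_simp
      have e2 : d₀ / 2 * (16 / (α * sd) + 8 / d₀) = 8 * (d₀ / sd) / α + 4 := by
        field_simp
        ring
      have e3 : d₀ / sd = sd := by
        rw [div_eq_iff hsd0.ne', ← sq, hsd2]
      rw [e1, e2, e3] at this
      linarith
    have h28 : Real.sqrt 2 * Real.sqrt 8 = 4 := by
      rw [← Real.sqrt_mul (by norm_num : (0 : ℝ) ≤ 2)]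
      rw [show (2 * 8 : ℝ) = 4 ^ 2 by norm_num]
      exact Real.sqrt_sq (by norm_num)
    have hq2 : 8 * sd / α ≤ 32 / Real.sqrt a := by
      rw [hsa, div_le_div_iff₀ hα0 (by positivity)]
      have h80 : 0 ≤ Real.sqrt 8 := Real.sqrt_nonneg _
      have h1 := mul_le_mul_of_nonneg_right (mul_le_mul_of_nonneg_right hsd1 h80) hα0.le
      have h28α : Real.sqrt 2 * Real.sqrt 8 * α = 4 * α := by rw [h28]
      have e : 8 * sd * (Real.sqrt 8 * α) = 8 * (sd * Real.sqrt 8 * α) := by ring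
      rw [e]
      linarith
    exact Real.log_le_log (by positivity) (by linarith)
  -- conclusion
  have hlog0 : 0 < Real.log (4 + 32 / Real.sqrt a) := lt_of_lt_of_le (by linarith) (hℓ1.trans hℓle)
  have hfin : sd * a / (4096 * Real.log (4 + 32 / Real.sqrt a)) * (L : ℝ) ^ 2 ≤ K := by
    rw [div_mul_eq_mul_div, div_le_iff₀ (by positivity)]
    have hℓ0 : 0 ≤ ℓ := by linarith
    calc sd * a * (L : ℝ) ^ 2 = a * sd * (L : ℝ) ^ 2 := by ring
      _ ≤ 3200 * K * ℓ := hcore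
      _ ≤ 3200 * K * Real.log (4 + 32 / Real.sqrt a) :=
          mul_le_mul_of_nonneg_left hℓle (mul_nonneg (by norm_num) hK0)
      _ ≤ K * (4096 * Real.log (4 + 32 / Real.sqrt a)) := by
          have := mul_nonneg hK0 hlog0.le
          have e1 : 3200 * K * Real.log (4 + 32 / Real.sqrt a) = 3200 * (K * Real.log (4 + 32 / Real.sqrt a)) := by ring
          have e2 : K * (4096 * Real.log (4 + 32 / Real.sqrt a)) = 4096 * (K * Real.log (4 + 32 / Real.sqrt a)) := by ring
          rw [e1, e2]
          linarith
  rw [hK] at hfin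
  linarith

end Literature.MathematicalPhysics.QuantumLattice
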